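import Literature.Barriers.ABC.EpsilonCannotBeDroppedHolds
import HarnessLib

/-!
# Crux `Target` (stmt-ABC-2159, route ABC/FeketeScales) — NEGATIVE LEMMA toolkit, part 1:
# Stewart–Tijdeman's triples with a forced divisor

`exists_triple_cform_forced` — Stewart–Tijdeman's pigeonhole (Bombieri–Gubler 12.4.10; tree:
`Literature.Barriers.ABC.StewartTijdeman.exists_triple_of_card_lt`, `exists_smooth_finset` and the
prime-number-theorem lemmas of `EpsilonCannotBeDroppedHolds.lean`) run modulo `m = 2^k · D` for an
ARBITRARY `D ≥ 1` whose prime factors exceed the smoothness bound `y` and with `log D ≤ y/(2 log y)`: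
for all large `y` an abc triple with `c ≤ e^{y²}`, `c ≥ y`, `D ∣ b` and
`rad(abc) · exp((2 − η/2) y/log y) < c · D` — the forced divisor costs exactly `log D` of excess and
nothing else.  Used by `TailExponentFloor.lean` (sibling) to put `⌊y^{2τ}⌋ + 2` prescribed primes into
`b`, refuting the ultra-composite-tail stub of line SketchIdeator2 for every exponent `< 1/2`.
No definitions. [cite: BombieriGubler2006, Thm. 12.4.6, 12.4.10] [cite: StewartTijdeman1986, Theorem 2]
-/

noncomputable section

open Literature.NumberTheory.DiophantineGeometry UniqueFactorizationMonoid Finset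
open Filter Asymptotics
open Literature.Barriers.ABC Literature.Barriers.ABC.StewartTijdeman

set_option linter.dupNamespace false

namespace Summit.ABC.ABC.Theorems.Target.Negative

set_option maxHeartbeats 400000 in
/-- **Stewart–Tijdeman's triples with a forced divisor (Bombieri–Gubler 12.4.10 modulo `2^k · D`).**
For `0 < η ≤ 1` and all large `y`: for every `D ≥ 1` all of whose prime factors exceed `y` and with
`log D ≤ y / (2 log y)` there is an abc triple with `c ≤ e^{y²}`, `c ≥ y`, `D ∣ b` and
`rad(abc) · exp((2 − η/2) y / log y) < c · D`.  Proof: the odd `y`-smooth numbers up to `x = e^{y²}`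
(at least `B = (log x)^n/(n! ∏ log p)` of them, `n = π(y) − 1`), pigeonhole modulo `m = 2^k D` with
`m < #S ≤ 2m` (possible since `log D < log B`), the gcd step (`m ∣ b`, `rad(abc)·m ≤ e^{ϑ(y)}·2D·b`), and
the estimate of `StewartTijdeman.exists_triple_cform` verbatim.
[cite: BombieriGubler2006, Thm. 12.4.6, 12.4.10] -/
theorem exists_triple_cform_forced {η : ℝ} (hη : 0 < η) (hη1 : η ≤ 1) :
    ∃ y₀ : ℕ, ∀ y : ℕ, y₀ ≤ y → ∀ D : ℕ, 0 < D → (∀ p ∈ D.primeFactors, y < p) →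
      Real.log (D : ℝ) ≤ (y : ℝ) / (2 * Real.log y) →
      ∃ a b c : ℕ, IsABCTriple a b c ∧ (c : ℝ) ≤ Real.exp ((y : ℝ) ^ 2) ∧ y ≤ c ∧ D ∣ b ∧
        (rad a b c : ℝ) * Real.exp ((2 - η / 2) * y / Real.log y) < c * D := by
  set ε : ℝ := η / 16 with hεdef
  have hε : 0 < ε := by positivity
  have hε16 : ε ≤ 1 / 16 := by rw [hεdef]; linarith
  have hε1 : ε ≤ 1 := by linarith
  have hev : ∀ᶠ y : ℝ in atTop,
      ((1 - ε) * (y / Real.log y) ≤ (Nat.primeCounting ⌊y⌋₊ : ℝ) ∧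
        (Nat.primeCounting ⌊y⌋₊ : ℝ) ≤ (1 + ε) * (y / Real.log y)) ∧
      ((1 - ε) * (y / Real.log y) ≤
          (Nat.primeCounting ⌊y⌋₊ : ℝ) * Real.log y - Chebyshev.theta y ∧
        (Real.log y ^ 2 ≤ ε * y ∧ Real.exp 4 ≤ y)) :=
    (eventually_primeCounting_bounds hε).and
      ((eventually_primeCounting_mul_log_sub_theta_ge hε hε1).and
        ((eventually_log_sq_le hε).and (eventually_ge_atTop _)))
  obtain ⟨y₁, hy₁⟩ := Filter.eventually_atTop.mp hev
  refine ⟨max ⌈y₁⌉₊ 3, fun y hy D hD0 hDprime hlogD => ?_⟩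
  have hy3 : 3 ≤ y := le_trans (le_max_right _ _) hy
  have hyy₁ : y₁ ≤ (y : ℝ) :=
    le_trans (Nat.le_ceil y₁) (by exact_mod_cast le_trans (le_max_left _ _) hy)
  obtain ⟨⟨hπge, hπle⟩, hE3, hE4, hexp4⟩ := hy₁ y hyy₁
  rw [Nat.floor_natCast] at hπge hπle hE3
  -- abbreviations: `L = log y`, `Y = y / log y`
  set yr : ℝ := (y : ℝ) with hyr
  set L : ℝ := Real.log yr with hL
  set πy : ℝ := (Nat.primeCounting y : ℝ) with hπy
  have hyr3 : (3 : ℝ) ≤ yr := by rw [hyr]; exact_mod_cast hy3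
  have hyr0 : 0 < yr := by linarith
  have hL4 : 4 ≤ L := by
    rw [hL, ← Real.log_exp 4]; exact Real.log_le_log (Real.exp_pos 4) hexp4
  have hL0 : 0 < L := by linarith
  set Y : ℝ := yr / L with hY
  have hY0 : 0 < Y := div_pos hyr0 hL0
  have hLY : L ≤ ε * Y := by
    rw [hY, ← mul_div_assoc, le_div_iff₀ hL0]
    calc L * L = L ^ 2 := (sq L).symm
      _ ≤ ε * yr := hE4
  have hεY : ε * Y ≤ Y / 16 := by
    have := mul_le_mul_of_nonneg_right hε16 hY0.le
    linarith
  have hYle : Y ≤ yr / 4 := by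
    rw [hY]; exact div_le_div_of_nonneg_left hyr0.le (by norm_num) hL4
  have hlogD' : Real.log (D : ℝ) ≤ Y / 2 := by
    rw [hY]
    calc Real.log (D : ℝ) ≤ yr / (2 * L) := hlogD
      _ = yr / L / 2 := by rw [div_div, mul_comm]
  -- the odd primes up to `y`
  set P : Finset ℕ := (Nat.primesLE y).erase 2 with hPdef
  have hPprime : ∀ p ∈ P, p.Prime := fun p hp => (Nat.mem_primesLE.mp (mem_of_mem_erase hp)).2
  have hPle : ∀ p ∈ P, p ≤ y := fun p hp => (Nat.mem_primesLE.mp (mem_of_mem_erase hp)).1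
  have hPne2 : ∀ p ∈ P, p ≠ 2 := fun p hp => ne_of_mem_erase hp
  have hP3 : 3 ∈ P := mem_erase.mpr ⟨by norm_num, Nat.mem_primesLE.mpr ⟨hy3, Nat.prime_three⟩⟩
  have h2mem : 2 ∈ Nat.primesLE y := Nat.mem_primesLE.mpr ⟨by omega, Nat.prime_two⟩
  set n : ℕ := P.card with hndef
  have hncard : n = Nat.primeCounting y - 1 := by
    rw [hndef, hPdef, card_erase_of_mem h2mem, Nat.primesLE_card_eq_primeCounting]
  have hn1 : 1 ≤ n := card_pos.mpr ⟨3, hP3⟩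
  have hπ1 : 1 ≤ Nat.primeCounting y := by
    rw [← Nat.primesLE_card_eq_primeCounting]; exact card_pos.mpr ⟨2, h2mem⟩
  have hnR : (n : ℝ) = πy - 1 := by
    rw [hncard, Nat.cast_sub hπ1, Nat.cast_one]
  have hn0R : (0 : ℝ) < n := by exact_mod_cast hn1
  have hn1R : (1 : ℝ) ≤ n := by exact_mod_cast hn1
  -- the odd `y`-smooth numbers up to `x = e^{y²}`
  set X : ℝ := Real.exp (yr ^ 2) with hXdef
  have hX1 : 1 ≤ X := Real.one_le_exp (by positivity)
  have hlogX : Real.log X = yr ^ 2 := Real.log_exp _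
  obtain ⟨S, hSmem, hSbound⟩ := exists_smooth_finset P hPprime X
  have hScard := hSbound hX1
  rw [hlogX] at hScard
  set Pl : ℝ := ∏ p ∈ P, Real.log p with hPl
  have hlogp : ∀ p ∈ P, 0 < Real.log (p : ℝ) := fun p hp =>
    Real.log_pos (by exact_mod_cast (hPprime p hp).one_lt)
  have hPl0 : 0 < Pl := prod_pos hlogp
  set B : ℝ := (yr ^ 2) ^ n / ((n.factorial : ℝ) * Pl) with hB
  have hB0 : 0 < B := by positivity
  set N : ℕ := S.card with hN
  have hBN : B ≤ (N : ℝ) := hScard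
  -- `log B ≥ n L − n ε + n − L/2 − 1`
  have hlogB : Real.log B = 2 * n * L - Real.log (n.factorial : ℝ) -
      ∑ p ∈ P, Real.log (Real.log p) := by
    rw [hB, Real.log_div (by positivity) (by positivity), Real.log_mul (by positivity) hPl0.ne',
      Real.log_pow, Real.log_pow, hPl, Real.log_prod (fun p hp => (hlogp p hp).ne')]
    push_cast
    ring
  have hSt : Real.log (n.factorial : ℝ) ≤ n * Real.log n - n + Real.log n / 2 + 1 :=
    log_factorial_le hn1
  have hsum : ∑ p ∈ P, Real.log (Real.log p) ≤ n * Real.log L := by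
    have h : ∀ p ∈ P, Real.log (Real.log (p : ℝ)) ≤ Real.log L := by
      intro p hp
      have hp2 : (2 : ℝ) ≤ p := by exact_mod_cast (hPprime p hp).two_le
      have hpy : (p : ℝ) ≤ yr := by rw [hyr]; exact_mod_cast hPle p hp
      exact Real.log_le_log (hlogp p hp) (Real.log_le_log (by linarith) hpy)
    calc ∑ p ∈ P, Real.log (Real.log (p : ℝ)) ≤ ∑ p ∈ P, Real.log L := sum_le_sum h
      _ = n * Real.log L := by rw [sum_const, nsmul_eq_mul, hndef]
  have hnπ : (n : ℝ) ≤ πy := by rw [hnR]; linarith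
  have hlogY : Real.log Y = L - Real.log L := by
    rw [hY, Real.log_div hyr0.ne' hL0.ne']
  have hlogn : Real.log n ≤ ε + L - Real.log L := by
    have h1 : (n : ℝ) ≤ (1 + ε) * Y := hnπ.trans hπle
    have h2 : Real.log n ≤ Real.log ((1 + ε) * Y) := Real.log_le_log hn0R h1
    rw [Real.log_mul (by linarith) hY0.ne', hlogY] at h2
    have h3 : Real.log (1 + ε) ≤ ε := by
      have := Real.log_le_sub_one_of_pos (by linarith : (0 : ℝ) < 1 + ε); linarith
    linarith
  have hlogL1 : 1 ≤ Real.log L := by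
    rw [← Real.log_exp 1]
    refine Real.log_le_log (Real.exp_pos 1) ?_
    have := Real.exp_one_lt_d9
    linarith
  have hlognL : Real.log n ≤ L := by linarith
  have hlogBge : (n : ℝ) * L - n * ε + n - L / 2 - 1 ≤ Real.log B := by
    rw [hlogB]
    have h1 : (n : ℝ) * Real.log n ≤ n * (ε + L - Real.log L) :=
      mul_le_mul_of_nonneg_left hlogn hn0R.le
    linarith
  -- `log B > yr / 8 ≥ log D`, hence `D < N`
  have hπL : (1 - ε) * yr ≤ πy * L := by
    have := mul_le_mul_of_nonneg_right hπge hL0.le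
    rwa [hY, mul_assoc, div_mul_cancel₀ _ hL0.ne'] at this
  have hlogB_gt : yr / 8 < Real.log B := by
    have hnL : (n : ℝ) * L = πy * L - L := by rw [hnR]; ring
    have hnε : (n : ℝ) * ε ≤ n := mul_le_of_le_one_right hn0R.le hε1
    have hεyr : ε * yr ≤ yr / 16 := by
      have := mul_le_mul_of_nonneg_right hε16 hyr0.le; linarith
    have hLsmall : L ≤ yr / 64 := by linarith [hLY, hεY, hYle]
    linarith [hlogBge, hπL, hnL, hnε, hεyr, hLsmall, hyr3]
  have hlogN : Real.log B ≤ Real.log N := Real.log_le_log hB0 hBN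
  have hN0R' : (0 : ℝ) < N := lt_of_lt_of_le hB0 hBN
  have hDN : D < N := by
    have hD0R : (0 : ℝ) < D := by exact_mod_cast hD0
    have h1 : Real.log (D : ℝ) < Real.log N := by
      have : Y / 2 ≤ yr / 8 := by linarith
      linarith
    have h2 : (D : ℝ) < N := (Real.log_lt_log_iff hD0R hN0R').mp h1
    exact_mod_cast h2
  have hN2 : 2 ≤ N := by omega
  -- the modulus `m = 2^k · D`, `m < N ≤ 2 m`
  set t : ℕ := (N - 1) / D with ht
  have ht1 : 1 ≤ t := by
    rw [ht, Nat.le_div_iff_mul_le hD0, one_mul]; omega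
  set k : ℕ := Nat.log 2 t with hk
  set m : ℕ := 2 ^ k * D with hm
  have hm0 : 0 < m := Nat.mul_pos (pow_pos two_pos k) hD0
  have hmN : m < N := by
    have h1 : 2 ^ k ≤ t := Nat.pow_log_le_self 2 (by omega)
    have h2 : 2 ^ k * D ≤ t * D := Nat.mul_le_mul_right D h1
    have h3 : t * D ≤ N - 1 := Nat.div_mul_le_self (N - 1) D
    omega
  have hN2m : N ≤ 2 * m := by
    have h1 : t < 2 ^ (k + 1) := Nat.lt_pow_succ_log_self one_lt_two t
    have h2 : N - 1 < 2 ^ (k + 1) * D := by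
      rw [ht] at h1; exact (Nat.div_lt_iff_lt_mul hD0).mp h1
    have h3 : 2 ^ (k + 1) * D = 2 * m := by rw [hm, pow_succ]; ring
    omega
  -- pigeonhole and the gcd step
  have hPm : ∀ p ∈ P, ¬ p ∣ m := by
    intro p hp hdvd
    rcases (Nat.Prime.dvd_mul (hPprime p hp)).mp hdvd with h | h
    · exact hPne2 p hp ((Nat.prime_dvd_prime_iff_eq (hPprime p hp) Nat.prime_two).mp
        ((hPprime p hp).dvd_of_dvd_pow h))
    · have hmem : p ∈ D.primeFactors := Nat.mem_primeFactors.mpr ⟨hPprime p hp, h, hD0.ne'⟩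
      exact absurd (hDprime p hmem) (not_lt.mpr (hPle p hp))
  obtain ⟨a, b, c, habc, ⟨s, hs, hcs⟩, hmb, hradm⟩ :=
    exists_triple_of_card_lt hPprime hm0 (fun s hs => ⟨(hSmem s hs).1, (hSmem s hs).2.2⟩) hPm hmN
  have hrad2D : radical m ≤ 2 * D := by
    have h2 : radical (2 ^ k : ℕ) ∣ 2 := by
      have := radical_pow_dvd (a := (2 : ℕ)) (n := k)
      rwa [radical_of_prime Nat.prime_two.prime, normalize_eq] at this
    have hdvd : radical m ∣ 2 * D :=
      (radical_mul_dvd (a := 2 ^ k) (b := D)).trans (mul_dvd_mul h2 radical_dvd_self)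
    exact Nat.le_of_dvd (by omega) hdvd
  have hDb : D ∣ b := (Dvd.intro_left _ rfl : D ∣ 2 ^ k * D).trans hmb
  -- `∏_{p ∈ P} p ≤ e^{ϑ(y)}`
  set Q : ℕ := ∏ p ∈ P, p with hQ
  have hQpos : 0 < Q := prod_pos fun p hp => (hPprime p hp).pos
  have hlogQ : Real.log (Q : ℝ) ≤ Chebyshev.theta yr := by
    rw [hyr, Chebyshev.theta_eq_sum_primesLE_log y, hQ, Nat.cast_prod,
      Real.log_prod (fun p hp => ?_)]
    · refine sum_le_sum_of_subset_of_nonneg (erase_subset _ _) fun p hp _ => ?_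
      exact Real.log_natCast_nonneg p
    · exact_mod_cast (hPprime p hp).ne_zero
  -- the triple
  obtain ⟨ha0, hb0, hsumabc, hcop⟩ := habc
  have hbc : b < c := by omega
  have hc0 : 0 < c := by omega
  have hkey : rad a b c * m < 2 * D * Q * c := by
    calc rad a b c * m ≤ Q * radical m * b := hradm
      _ ≤ Q * (2 * D) * b := Nat.mul_le_mul_right _ (Nat.mul_le_mul_left _ hrad2D)
      _ < Q * (2 * D) * c := Nat.mul_lt_mul_of_pos_left hbc (by positivity)
      _ = 2 * D * Q * c := by ring
  have hkeyR : (rad a b c : ℝ) * m < 2 * D * Q * c := by exact_mod_cast hkey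
  have hrad1 : 1 ≤ rad a b c := by rw [rad_def]; exact Nat.radical_pos _
  have hrad0 : (0 : ℝ) < rad a b c := by exact_mod_cast hrad1
  have hm0R : (0 : ℝ) < m := by exact_mod_cast hm0
  have hQ0R : (0 : ℝ) < Q := by exact_mod_cast hQpos
  have hc0R : (0 : ℝ) < c := by exact_mod_cast hc0
  have hD0R : (0 : ℝ) < D := by exact_mod_cast hD0
  have hN0R : (0 : ℝ) < N := hN0R'
  have hlogkey : Real.log (rad a b c) + Real.log m <
      Real.log 2 + Real.log D + Real.log Q + Real.log c := by
    have := Real.log_lt_log (by positivity) hkeyR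
    rwa [Real.log_mul hrad0.ne' hm0R.ne', Real.log_mul (by positivity) hc0R.ne',
      Real.log_mul (by positivity) hQ0R.ne', Real.log_mul two_ne_zero hD0R.ne'] at this
  have hlogm : Real.log N ≤ Real.log 2 + Real.log m := by
    have h : (N : ℝ) ≤ 2 * m := by exact_mod_cast hN2m
    have := Real.log_le_log hN0R h
    rwa [Real.log_mul (by norm_num) hm0R.ne'] at this
  have hlog4 : Real.log 2 + Real.log 2 < 2.1 := by
    have := Real.log_two_lt_d9
    linarith
  -- the estimate `log c + log D − log rad > (2 − η/2) Y`
  have hf2 : ((1 - ε) * Y - 1) * (1 - ε) ≤ (πy - 1) * (1 - ε) :=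
    mul_le_mul_of_nonneg_right (by linarith) (by linarith)
  have hε2Y : 0 ≤ ε ^ 2 * Y := by positivity
  have hfinal : Real.log (rad a b c) + (2 - η / 2) * Y < Real.log c + Real.log D := by
    have hη16 : η / 2 = 8 * ε := by rw [hεdef]; ring
    rw [hη16]
    rw [hnR] at hlogBge
    linarith only [hlogBge, hE3, hf2, hε2Y, hLY, hL4, hlogkey, hlogm, hlogN, hlog4, hlogQ, hε,
      hY0]
  refine ⟨a, b, c, ⟨ha0, hb0, hsumabc, hcop⟩, ?_, ?_, hDb, ?_⟩
  · -- `c ≤ s ≤ X`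
    exact le_trans (by exact_mod_cast hcs) (hSmem s hs).2.1
  · -- `y ≤ c`
    have hlogyc : Real.log yr < Real.log c := by
      have h0 : 0 ≤ Real.log (rad a b c : ℝ) := Real.log_nonneg (by exact_mod_cast hrad1)
      have h1 : (3 / 2 : ℝ) * Y ≤ (2 - η / 2) * Y := mul_le_mul_of_nonneg_right (by linarith) hY0.le
      have hYL : L ≤ Y := by
        have : L ≤ Y / 16 := hLY.trans hεY
        linarith
      rw [← hL]
      linarith
    have : yr < c := (Real.log_lt_log_iff hyr0 hc0R).mp hlogyc
    rw [hyr] at this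
    exact_mod_cast this.le
  · have hE : (2 - η / 2) * yr / L = (2 - η / 2) * Y := by rw [hY, mul_div_assoc]
    calc (rad a b c : ℝ) * Real.exp ((2 - η / 2) * yr / L)
        = Real.exp (Real.log (rad a b c) + (2 - η / 2) * Y) := by
          rw [hE, Real.exp_add, Real.exp_log hrad0]
      _ < Real.exp (Real.log c + Real.log D) := Real.exp_lt_exp.mpr hfinal
      _ = c * D := by rw [Real.exp_add, Real.exp_log hc0R, Real.exp_log hD0R]

end Summit.ABC.ABC.Theorems.Target.Negative
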